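import Mathlib
import Summits.KontsevichZagierPeriods.KontsevichZagierPeriods.Theorems.SoloInformedFibreInterval
import Literature.ModelTheory.ExponentialFields.CylindricalDecomposition
import Literature.NumberTheory.Sieve.FordMaynardSliceBlocks
import HarnessLib

/-!
# Solo-informed (A390-ii): Tonelli over the last coordinate for bands and graphs

File F3b of the KERNEL LEMMA I programme.  Measure-theoretic plumbing for integrating a
function of `z = (t, x) ∈ ℝᵏ⁺ᵐ⁺¹` over the variables `x ∈ ℝᵐ⁺¹` with the parameter `t ∈ ℝᵏ` fixed,
splitting off the last variable:

* `soloInformed_lintegral_finSucc` — `∫ Φ(x) dx = ∫ (∫ Φ(x', y) dy) dx'` on `ℝᵐ⁺¹`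
  (`MeasurableEquiv.piFinSuccAbove` at `Fin.last m` and Tonelli);
* `soloInformed_lintegral_fin_zero` — integration over `ℝ⁰` is evaluation;
* measurability of `(w, y) ↦ Fin.snoc w y` and of
  fibre integrals `w ↦ ∫ Φ (Fin.snoc w y) dy`;
* fibres of cells: the vertical fibre of `bandOver S ξ j` over `w ∈ S` is the extended interval
  `soloInformedEIoo (bandLower ξ j w) (bandUpper ξ j w)` (empty over `w ∉ S`), and the fibre
  integral over a graph cell vanishes;
* the parametric forms `soloInformed_lintegral_bandOver_append` /
  `soloInformed_lintegral_graphOver_append`: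
  `∫ 1_band G (t, x) dx = ∫ 1_S(t, x') (∫_{fibre} G (t, x', y) dy) dx'` and `∫ 1_graph G (t, x) dx = 0`.
-/

open MeasureTheory Set
open scoped ENNReal
open Literature.ModelTheory.ExponentialFields Literature.NumberTheory.Sieve

namespace Summit.KontsevichZagierPeriods.KontsevichZagierPeriods.Theorems

/-! ### Measurability of the coordinate maps -/

/-! `x ↦ (t, x)` and `y ↦ (w, y)` are measurable: cited from the tree as
`Literature.NumberTheory.Sieve.FordMaynard.measurable_append_right` /
`Literature.NumberTheory.Sieve.FordMaynard.measurable_snoc_right` (not restated). -/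

/-- `(w, y) ↦ (w, y)` (uncurried `Fin.snoc`) is measurable. -/
theorem soloInformed_measurable_snoc_uncurry (n : ℕ) :
    Measurable fun p : (Fin n → ℝ) × ℝ => (Fin.snoc p.1 p.2 : Fin (n + 1) → ℝ) := by
  refine measurable_pi_lambda _ fun i => ?_
  induction i using Fin.lastCases with
  | last => simp only [Fin.snoc_last]; exact measurable_snd
  | cast i => simp only [Fin.snoc_castSucc]; exact (measurable_pi_apply i).comp measurable_fst

/-- Fibre integrals of a measurable function are measurable in the base point. -/
theorem soloInformed_measurable_lintegral_snoc {n : ℕ} {Φ : (Fin (n + 1) → ℝ) → ℝ≥0∞}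
    (hΦ : Measurable Φ) : Measurable fun w : Fin n → ℝ => ∫⁻ y, Φ (Fin.snoc w y) :=
  (hΦ.comp (soloInformed_measurable_snoc_uncurry n)).lintegral_prod_right'

/-! ### Tonelli over the last coordinate -/

/-- **Splitting off the last variable**: for measurable `Φ ≥ 0` on `ℝᵐ⁺¹`,
`∫ Φ = ∫ (∫ Φ (x', y) dy) dx'`. -/
theorem soloInformed_lintegral_finSucc (m : ℕ) {Φ : (Fin (m + 1) → ℝ) → ℝ≥0∞}
    (hΦ : Measurable Φ) :
    ∫⁻ x, Φ x = ∫⁻ x' : Fin m → ℝ, ∫⁻ y : ℝ, Φ (Fin.snoc x' y) := by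
  have he := volume_preserving_piFinSuccAbove (fun _ : Fin (m + 1) => ℝ) (Fin.last m)
  rw [← (he.symm _).lintegral_comp_emb (MeasurableEquiv.measurableEmbedding _) Φ]
  have hmeas : Measurable fun z : ℝ × (Fin m → ℝ) =>
      Φ ((MeasurableEquiv.piFinSuccAbove (fun _ : Fin (m + 1) => ℝ) (Fin.last m)).symm z) :=
    hΦ.comp (MeasurableEquiv.measurable _)
  rw [show (volume : Measure (ℝ × (Fin m → ℝ))) = volume.prod volume from rfl,
    lintegral_prod_symm' _ hmeas]
  refine lintegral_congr fun x' => lintegral_congr fun y => ?_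
  simp only [MeasurableEquiv.piFinSuccAbove_symm_apply, Fin.insertNthEquiv_last]
  rfl

/-- Integration over `ℝ⁰ = {pt}` is evaluation. -/
theorem soloInformed_lintegral_fin_zero (Φ : (Fin 0 → ℝ) → ℝ≥0∞) :
    ∫⁻ x, Φ x = Φ Fin.elim0 := by
  have hΦ : Φ = fun _ => Φ Fin.elim0 := funext fun x => by rw [Subsingleton.elim x Fin.elim0]
  rw [hΦ, lintegral_const]
  have : (volume : Measure (Fin 0 → ℝ)) univ = 1 := by
    rw [volume_pi, Measure.pi_univ]
    simp
  rw [this, mul_one]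

/-! ### Fibres of bands and graphs -/

/-- The vertical fibre of a band over a base point of `S` is the extended open interval between
its boundary values. -/
theorem soloInformed_bandOver_fibre {n l : ℕ} {S : Set (Fin n → ℝ)}
    (ξ : Fin l → (Fin n → ℝ) → ℝ) (j : Fin (l + 1)) {w : Fin n → ℝ} (hw : w ∈ S) :
    {y : ℝ | (Fin.snoc w y : Fin (n + 1) → ℝ) ∈ bandOver S ξ j} =
      soloInformedEIoo (bandLower ξ j w) (bandUpper ξ j w) := by
  ext y
  simp only [mem_setOf_eq, snoc_mem_bandOver_iff, soloInformed_mem_EIoo, hw, true_and]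

/-- The band indicator evaluated on a vertical line is the base indicator times the fibre
indicator. -/
theorem soloInformed_bandOver_indicator_snoc {n l : ℕ} (S : Set (Fin n → ℝ))
    (ξ : Fin l → (Fin n → ℝ) → ℝ) (j : Fin (l + 1)) (G : (Fin (n + 1) → ℝ) → ℝ≥0∞)
    (w : Fin n → ℝ) (y : ℝ) :
    (bandOver S ξ j).indicator G (Fin.snoc w y) =
      S.indicator (fun w => (soloInformedEIoo (bandLower ξ j w) (bandUpper ξ j w)).indicator
        (fun y => G (Fin.snoc w y)) y) w := by
  by_cases hw : w ∈ S
  · rw [indicator_of_mem hw]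
    by_cases hy : y ∈ soloInformedEIoo (bandLower ξ j w) (bandUpper ξ j w)
    · rw [indicator_of_mem hy, indicator_of_mem]
      rw [← mem_setOf_eq (p := fun y : ℝ => (Fin.snoc w y : Fin (n + 1) → ℝ) ∈ bandOver S ξ j),
        soloInformed_bandOver_fibre ξ j hw]
      exact hy
    · rw [indicator_of_notMem hy, indicator_of_notMem]
      rw [← mem_setOf_eq (p := fun y : ℝ => (Fin.snoc w y : Fin (n + 1) → ℝ) ∈ bandOver S ξ j),
        soloInformed_bandOver_fibre ξ j hw]
      exact hy
  · rw [indicator_of_notMem hw, indicator_of_notMem]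
    exact fun h => hw (snoc_mem_bandOver_iff.mp h).1

/-- **Fibre integral over a band**: `∫ 1_band G (w, y) dy = 1_S(w) ∫_{fibre(w)} G (w, y) dy`. -/
theorem soloInformed_lintegral_bandOver_snoc {n l : ℕ} (S : Set (Fin n → ℝ))
    (ξ : Fin l → (Fin n → ℝ) → ℝ) (j : Fin (l + 1)) (G : (Fin (n + 1) → ℝ) → ℝ≥0∞)
    (w : Fin n → ℝ) :
    ∫⁻ y, (bandOver S ξ j).indicator G (Fin.snoc w y) =
      S.indicator (fun w => ∫⁻ y in soloInformedEIoo (bandLower ξ j w) (bandUpper ξ j w),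
        G (Fin.snoc w y)) w := by
  simp_rw [soloInformed_bandOver_indicator_snoc S ξ j G w]
  by_cases hw : w ∈ S
  · simp_rw [indicator_of_mem hw]
    rw [lintegral_indicator (soloInformed_measurableSet_EIoo _ _)]
  · simp_rw [indicator_of_notMem hw]
    exact lintegral_zero

/-- **Fibre integral over a graph cell vanishes** (the fibre is at most one point). -/
theorem soloInformed_lintegral_graphOver_snoc {n : ℕ} (S : Set (Fin n → ℝ))
    (η : (Fin n → ℝ) → ℝ) (G : (Fin (n + 1) → ℝ) → ℝ≥0∞) (w : Fin n → ℝ) :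
    ∫⁻ y, (graphOver S η).indicator G (Fin.snoc w y) = 0 := by
  have hae : ∀ᵐ y : ℝ, (graphOver S η).indicator G (Fin.snoc w y) = 0 := by
    rw [ae_iff]
    refine measure_mono_null (fun y hy => ?_) (measure_singleton (η w))
    rw [mem_singleton_iff]
    by_contra hne
    refine hy (indicator_of_notMem (fun h => ?_) _)
    exact hne (snoc_mem_graphOver_iff.mp h).2
  rw [lintegral_congr_ae hae, lintegral_zero]

/-! ### Parametric forms: integrating over `x ∈ ℝᵐ⁺¹` with `t ∈ ℝᵏ` fixed -/

/-- **Band cells, parametric Tonelli**: for measurable `G ≥ 0` and a measurable band,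
`∫ 1_band G (t, x) dx = ∫ 1_S (t, x') (∫_{fibre(t, x')} G (t, x', y) dy) dx'`. -/
theorem soloInformed_lintegral_bandOver_append {k m l : ℕ} {S : Set (Fin (k + m) → ℝ)}
    (ξ : Fin l → (Fin (k + m) → ℝ) → ℝ) (j : Fin (l + 1))
    (hband : MeasurableSet (bandOver S ξ j)) {G : (Fin (k + m + 1) → ℝ) → ℝ≥0∞}
    (hG : Measurable G) (t : Fin k → ℝ) :
    ∫⁻ x : Fin (m + 1) → ℝ, (bandOver S ξ j).indicator G (Fin.append t x : Fin (k + (m + 1)) → ℝ) =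
      ∫⁻ x' : Fin m → ℝ, S.indicator (fun w =>
        ∫⁻ y in soloInformedEIoo (bandLower ξ j w) (bandUpper ξ j w), G (Fin.snoc w y))
        (Fin.append t x') := by
  have hΦ : Measurable fun x : Fin (m + 1) → ℝ =>
      (bandOver S ξ j).indicator G (Fin.append t x : Fin (k + (m + 1)) → ℝ) :=
    (hG.indicator hband).comp (FordMaynard.measurable_append_right t)
  rw [soloInformed_lintegral_finSucc m hΦ]
  refine lintegral_congr fun x' => ?_
  simp_rw [Fin.append_snoc]
  exact soloInformed_lintegral_bandOver_snoc S ξ j G _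

/-- **Graph cells carry no mass**: if the extension by zero `1_S η` is measurable then
`∫ 1_{graph η} G (t, x) dx = 0` for every `G` and every parameter `t`. -/
theorem soloInformed_lintegral_graphOver_append {k m : ℕ} {S : Set (Fin (k + m) → ℝ)}
    {η : (Fin (k + m) → ℝ) → ℝ} (hη : Measurable (S.indicator η))
    (G : (Fin (k + m + 1) → ℝ) → ℝ≥0∞) (t : Fin k → ℝ) :
    ∫⁻ x : Fin (m + 1) → ℝ, (graphOver S η).indicator G (Fin.append t x : Fin (k + (m + 1)) → ℝ) =
      0 := by
  -- the measurable superset `M = {x | x_last = (1_S η)(t, x')}` of the support is null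
  set c : (Fin m → ℝ) → ℝ := fun x' => S.indicator η (Fin.append t x') with hc
  have hcm : Measurable c := hη.comp (FordMaynard.measurable_append_right t)
  set M : Set (Fin (m + 1) → ℝ) := {x | x (Fin.last m) = c (Fin.init x)} with hM
  have hMm : MeasurableSet M := by
    refine measurableSet_eq_fun (measurable_pi_apply _) (hcm.comp ?_)
    exact measurable_pi_lambda _ fun i => measurable_pi_apply _
  have hMnull : volume M = 0 := by
    rw [← lintegral_indicator_one hMm,
      soloInformed_lintegral_finSucc m (measurable_one.indicator hMm)]
    have : ∀ x' : Fin m → ℝ, ∫⁻ y : ℝ, M.indicator (1 : (Fin (m + 1) → ℝ) → ℝ≥0∞)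
        (Fin.snoc x' y) = 0 := by
      intro x'
      have hae : ∀ᵐ y : ℝ, M.indicator (1 : (Fin (m + 1) → ℝ) → ℝ≥0∞) (Fin.snoc x' y) = 0 := by
        rw [ae_iff]
        refine measure_mono_null (fun y hy => ?_) (measure_singleton (c x'))
        rw [mem_singleton_iff]
        by_contra hne
        refine hy (indicator_of_notMem (fun h => ?_) _)
        rw [hM, mem_setOf_eq, Fin.snoc_last, Fin.init_snoc] at h
        exact hne h
      rw [lintegral_congr_ae hae, lintegral_zero]
    simp_rw [this, lintegral_zero]
  -- the integrand vanishes off `M`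
  have hae : ∀ᵐ x : Fin (m + 1) → ℝ,
      (graphOver S η).indicator G (Fin.append t x : Fin (k + (m + 1)) → ℝ) = 0 := by
    rw [ae_iff]
    refine measure_mono_null (fun x hx => ?_) hMnull
    rw [hM, mem_setOf_eq]
    by_contra hne
    refine hx (indicator_of_notMem (fun h => ?_) _)
    have hxe : (Fin.append t x : Fin (k + (m + 1)) → ℝ) =
        Fin.snoc (Fin.append t (Fin.init x)) (x (Fin.last m)) := by
      rw [← Fin.append_snoc, Fin.snoc_init_self]
    rw [hxe, snoc_mem_graphOver_iff] at h
    refine hne ?_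
    rw [hc]
    simp only [indicator_of_mem h.1]
    exact h.2
  rw [lintegral_congr_ae hae, lintegral_zero]

end Summit.KontsevichZagierPeriods.KontsevichZagierPeriods.Theorems
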